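import Summits.QuantumFields.YangMills.Theorems.UnitScaleTiltProp7FlatRigidity
import Literature.MathematicalPhysics.QuantumFieldTheory.Balaban1983to89.Node00.BackgroundActionT
import Summits.QuantumFields.YangMills.Theorems.BalabanUVNodesN07Prop8StepFlatWitness

/-!
# BalabanUVNodes ∕ N09 — THE FLAT SECTOR OF THE (0.21) PROBLEM AT THE T⁴ RECORD IS RIGID: [B11] Thm 1's clauses displayed on N09's doors
# (`h07sol ∕ h07res ∕ h07uniq`, `hreg8`) are KERNEL THEOREMS at every datum `V = M^k(U_f)` with `U_f` plaquette-flat — e.g. `V = 1`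

TRACK A (YM-PLAN §2b, node N09 of 28 = [B12] = [Balaban1987RG1] (CMP 109) Thm 3 p. 264 + Lemma 4 p. 280), WIDTH SEAT `pub-ymgap-dag-n09-w1` (g3;
HUMAN RULING D-0149, director-ym №197).  Key of record it serves: K1⁷ `StabilityBAtRecordR13SepCoPH` = stmt-QuantumFields-20542 (`--supports`, count-neutral
helper).  A NEW importing module; THEOREMS ONLY, def-free, sorry-free, standard axioms.  [I] = [Balaban1987RG1], [B11] = [Balaban1985Variational].

WHY.  Every N09 door of record (dag-n24-c 28H `…N24GenericCubeDoorSignFreeAllTorusN09OnDomainsReg8`, dag-n09-w2 g2 `…N09AxialCovariance181OnDomainsReg8`,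
dag-n09-w3 g2 `…N09AtSmallFieldBookkeeping`) displays [B11] Thm 1's three clauses at the record's objects — `h07sol` (`UkExists ∧ UniqueUkOrbit` on
`domAltOfRecord θ.ν P.K k` at radius `θ.εbg`), `h07res` (`HRestrict`), `h07uniq` (`UniqueUkOrbit` at the averaged minimisers `M^{j+1}(U_k V)`) — and the
(8)-clause `hreg8` (`U_k … εbg V ∈ bgReg … εreg`).  In the tree these are inhabited at level `k = 0` only (dag-n09-w1 g2 `h11_hreg8_hle_inhabited_zero`,
`hreg8_levelZero`) and, for EXISTENCE alone, at `V = 1` (dag-n09-w4 g2 `N09UkSelAtJunction.ukExists_one ∕ isBackground_one_one`).  THIS FILE proves ALL FOUR at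
every level `k ≤ m + K`, every radius `ε > 0`, at every datum of the FLAT SECTOR `V = M^k(U_f)`, `U_f` plaquette-flat (`V = 1`; every pure gauge of `1`;
the constant-abelian ∕ toron data): there the (0.21) problem is RIGID — a minimiser over such a `V` has Wilson action `≤ A(U_f) = 0` (a flat field lies in
every inhabited class `bgReg`), so it is plaquette-flat, hence holonomy-flat (lattice Stokes, ym3-torus `Prop7FlatDatum.holFlat_of_plaqHol_eq_one`), its
`k`-fold average of record is its field of straight `L^k`-segments (`Prop7FlatHolonomy.iter_blockAvg_eq_straightIter_of_flat` with `expMeanLogSU_E_one`), and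
two holonomy-flat fields with the same segments lie on ONE orbit of print's group (4) (`Prop7FlatRigidity.exists_gaugeAct_eq_of_segments`) — whose Lean
text `∃ u, (∀ y, u (embIter k y) = 1) ∧ U^{u} = U′` IS NODE 00's `B12GaugeOrbits021.OrbitRel k` (`IsResidual k u`).  The ym3-torus files are GENERIC in
`P : Params` and in the group; their carrier statements are T³ ∕ `SU(2)` ∕ `sameOrbit` ∕ `IsCritR2`; this file is the T⁴-RECORD twin at NODE 00's letters
(`T4Family`, `SU N`, `avOfRecord`, `bgReg`, `Uk`, `UkExists`, `UniqueUkOrbit`, `HRestrict`), a knit BY NAME.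

WHAT THIS FILE PROVES (record letters `F N K k ε`; `hk : k ≤ (F.P K).m + (F.P K).K` where print's group (4) is read at the `k`-centres).
§1 `plaqSmall_of_flat` (a plaquette-flat field lies in every INHABITED class `PlaqSmall δ`), `mem_bgReg_of_flat`, `iter_avOfRecord_eq_straight_of_flat`
   (the record's `M^k` on holonomy-flat fields); `M^k 1 = 1` is dag-n07-e's `N07Prop8StepFlatWitness.iter_avOfRecord_one` (cited, not restated).
§2 ★ `orbitRel_of_flat_of_iter_eq` (RIGIDITY: two plaquette-flat fine fields with the same `M^k` lie on one residual orbit), `flat_of_isBackground_of_flat`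
   (a minimiser over a flat-sector datum is plaquette-flat), `isBackground_of_flat` (a flat field in the class is a minimiser over its own `M^k`),
   ★★ `uniqueUkOrbit_of_flat_iter` ∕ `ukExists_of_flat_iter` ([B11] (1.1) BOTH CLAUSES on the sector), `flat_Uk_of_flat_iter` (`U_k(V)` is flat there),
   `Uk_mem_bgReg_of_flat_iter` (`U_k … ε V ∈ bgReg … k′ ε′` for EVERY level `k′` and radius `ε′ > 0` — `hreg8` on the sector for every pair of radii),
   `orbitRel_Uk_of_flat_iter` (`U_k(M^k U_f)` is on `U_f`'s orbit), `hRestrict_of_flat_iter` ∕ `huniq_of_flat_iter` (`h07res` ∕ `h07uniq` on the sector).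
§3 at `V = 1` (dag-n07-e's `iter_avOfRecord_one`): ★★ `uniqueUkOrbit_one : UniqueUkOrbit F N K k ε 1`, `h11_one`, `orbitRel_one_Uk_one : OrbitRel k 1 (Uk F N K k ε 1)`, `huniq_one`, `hRestrict_one`.

LOCATED WORD (for K0-numerics ∕ def-T ∕ dag-n24-c; kernel-certified here): on the flat sector `U_k … εbg V` is flat, hence lies in `bgReg … εreg` for EVERY
pair of radii — dag-n09-w1 g2's two-radii obstruction at the V18∕V19 witness (`εbg = 1 > a₀`, `not_εbg_le_a₀_theta13OfThm1CCMW`) is INVISIBLE on flat data,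
so no refutation of the 28H door's N09 list can come from the flat sector; the binders bite only at curved data, where [B11] Thm 1 is the content.

HONEST FRAMING: count-neutral kernel lattice-gauge bookkeeping BY NAME (ym3-torus's generic flat toolkit, NODE 00's definitions of record); NOTHING of
Bałaban's analysis asserted or used — [B11] Thm 1 in its regime (curved small fields) is untouched, the flat sector is its degenerate case; A6: every
theorem's antecedent is inhabited (`U_f := 1`); NO carrier of record re-pointed; N09 NOT discharged; K0⁷ ∕ K1⁷ NOT closed; counts unmoved (typed 28∕28 ·
discharged 5∕27); one finite four-torus programme at fixed `ε = L^{−K}` — R4 closes the conditional rung `BalabanLadder.UV` only; NOT ℝ⁴, NOT OS, NOT a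
mass gap; the Yang–Mills mass gap (Clay) is NOT proved by any of this.
-/

noncomputable section

namespace Summit.QuantumFields.YangMills.BalabanUVNodes.N09FlatSectorUniqueness

open scoped Matrix.Norms.L2Operator
open Literature.MathematicalPhysics.QuantumFieldTheory.Balaban1983to89
open Literature.MathematicalPhysics.QuantumFieldTheory.Balaban1983to89.T4Continuum
open Literature.MathematicalPhysics.QuantumFieldTheory.Balaban1983to89.Node00
open Literature.MathematicalPhysics.QuantumFieldTheory.Balaban1983to89.B12GaugeOrbits021 (OrbitRel IsResidual)
open Literature.MathematicalPhysics.QuantumFieldTheory.Balaban1983to89.B15DeterminingSets (embIter)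
open Literature.MathematicalPhysics.QuantumFieldTheory.Balaban1983to89.T3DescentFibreTower (expMeanLogSU_E_one holAt_one)
open Summit.QuantumFields.YangMills.Theorems.Prop7FlatHolonomy (iter_blockAvg_eq_straightIter_of_flat)
open Summit.QuantumFields.YangMills.Theorems.Prop7FlatDatum (plaqHol_eq_one_of_wilsonAction4_eq_zero holFlat_of_plaqHol_eq_one)
open Summit.QuantumFields.YangMills.Theorems.Prop7FlatRigidity (exists_gaugeAct_eq_of_segments wilsonAction4_eq_zero_of_holFlat)
open Summit.QuantumFields.YangMills.BalabanUVNodes.N07Prop8StepFlatWitness (iter_avOfRecord_one)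
open GaugeField (gaugeAct plaqHol)

variable {F : T4Family} {N : ℕ} [NeZero N]

/-! ## §1. Flat fields at the record: class membership and the `k`-fold average of record -/

/-- A plaquette-flat field lies in every INHABITED plaquette class: `PlaqSmall δ U′ → PlaqSmall δ U` (`dist1 1 = 0 ≤ dist1 (U′(∂p)) < δ`).
[cite: Balaban1987RG1, (1.2) p.260 (bookkeeping)] -/
theorem plaqSmall_of_flat {P : Params} {j : ℕ} {U : GaugeField P j (SU N)} (hU : ∀ p, plaqHol U p = 1) {δ : ℝ} {U' : GaugeField P j (SU N)}
    (h : PlaqSmall δ U') : PlaqSmall δ U := by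
  intro p
  rw [hU p, GaugeGroup.dist1_one]
  exact lt_of_le_of_lt (GaugeGroup.dist1_nonneg _) (h p)

/-- A plaquette-flat fine field lies in `bgReg F N K k ε` as soon as that class is inhabited — in particular for every `ε > 0` (inhabited by `U` itself:
`0 < ε·η_k²`). [cite: Balaban1987RG1, (1.2) p.260 (bookkeeping)] -/
theorem mem_bgReg_of_flat {K : ℕ} {U : GaugeField (F.P K) 0 (SU N)} (hU : ∀ p, plaqHol U p = 1) (k : ℕ) {ε : ℝ} (hε : 0 < ε) :
    U ∈ bgReg F N K k ε := by
  rw [mem_bgReg_iff]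
  intro p
  rw [hU p, GaugeGroup.dist1_one]
  have hL : (0 : ℝ) < ((F.P K).L : ℝ) := Nat.cast_pos.mpr (F.P K).L_pos
  exact mul_pos hε (pow_pos (by unfold Params.eta; exact pow_pos (inv_pos.mpr hL) k) 2)

/-- A plaquette-flat fine field lies in `bgReg F N K k ε` whenever SOME field does. [cite: Balaban1987RG1, (1.2) p.260 (bookkeeping)] -/
theorem mem_bgReg_of_flat_of_mem {K : ℕ} {U : GaugeField (F.P K) 0 (SU N)} (hU : ∀ p, plaqHol U p = 1) {k : ℕ} {ε : ℝ}
    {U' : GaugeField (F.P K) 0 (SU N)} (h : U' ∈ bgReg F N K k ε) : U ∈ bgReg F N K k ε := by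
  rw [mem_bgReg_iff] at h ⊢
  exact plaqSmall_of_flat hU h

/-- Plaquette-flat ⇒ holonomy-flat at the record's group `SU(N)` (ym3-torus `Prop7FlatDatum.holFlat_of_plaqHol_eq_one`, lattice Stokes).
[cite: Balaban1985Averaging, (19)–(20) p.21] -/
theorem holFlat_of_flat {P : Params} {j : ℕ} {U : GaugeField P j (SU N)} (hU : ∀ p, plaqHol U p = 1) :
    ∀ (x : Site P j) (w : List (Letter P.d)), (∀ ν, netDisp w ν = 0) → holAt U (walk x w) = 1 :=
  holFlat_of_plaqHol_eq_one U hU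

/-- **THE `k`-FOLD AVERAGE OF RECORD OF A HOLONOMY-FLAT FIELD IS ITS FIELD OF STRAIGHT `L^k`-SEGMENTS** — ym3-torus's
`Prop7FlatHolonomy.iter_blockAvg_eq_straightIter_of_flat` at `avOfRecord F N K = blockAvg expMeanLogSU` (`rfl`) with `expMeanLogSU_E_one`.
[cite: Balaban1987RG1, (0.4) p.253, (0.11) p.253] -/
theorem iter_avOfRecord_eq_straight_of_holFlat {K : ℕ} {U : GaugeField (F.P K) 0 (SU N)}
    (hflat : ∀ (x : Site (F.P K) 0) (w : List (Letter (F.P K).d)), (∀ ν, netDisp w ν = 0) → holAt U (walk x w) = 1) (k : ℕ) :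
    Averaging.iter (avOfRecord F N K) k U =
      fun c : PBond (F.P K) k => holAt U (walk (embIter k c.src) (List.replicate ((F.P K).L ^ k) (c.dir, true))) :=
  iter_blockAvg_eq_straightIter_of_flat (P := F.P K) ExpMeanLog.expMeanLogSU (fun n => expMeanLogSU_E_one n) U hflat k

/-- The same for a plaquette-flat field. [cite: Balaban1987RG1, (0.11) p.253] -/
theorem iter_avOfRecord_eq_straight_of_flat {K : ℕ} {U : GaugeField (F.P K) 0 (SU N)} (hU : ∀ p, plaqHol U p = 1) (k : ℕ) :
    Averaging.iter (avOfRecord F N K) k U =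
      fun c : PBond (F.P K) k => holAt U (walk (embIter k c.src) (List.replicate ((F.P K).L ^ k) (c.dir, true))) :=
  iter_avOfRecord_eq_straight_of_holFlat (holFlat_of_flat hU) k

/-- The trivial fine field is plaquette-flat. [cite: Balaban1985Averaging, (9) p.19] -/
theorem flat_one {P : Params} {j : ℕ} : ∀ p : Plaq P j, plaqHol (1 : GaugeField P j (SU N)) p = 1 := fun p => by
  unfold GaugeField.plaqHol
  simp only [show ∀ b : PBond P j, (1 : GaugeField P j (SU N)) b = 1 from fun _ => rfl, inv_one, mul_one]

/-! ## §2. Rigidity of the flat sector and [B11] Thm 1's clauses there -/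

/-- ★ **RIGIDITY OF THE FLAT SECTOR AT THE RECORD**: for `k ≤ m + K`, two plaquette-flat fine fields with the same `k`-fold average of record lie on ONE
orbit of the residual group of level `k` — print's group (4) «`u(y) = 1` for `y ∈ 𝔅_k`» (ym3-torus `Prop7FlatRigidity.exists_gaugeAct_eq_of_segments`; its
`∀ y, u (embIter k y) = 1` IS `IsResidual k u`). [cite: Balaban1985Variational, (4) p.278; Balaban1987RG1, (0.21) p.256] -/
theorem orbitRel_of_flat_of_iter_eq {K k : ℕ} (hk : k ≤ (F.P K).m + (F.P K).K) {U U' : GaugeField (F.P K) 0 (SU N)}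
    (hU : ∀ p, plaqHol U p = 1) (hU' : ∀ p, plaqHol U' p = 1) (h : Averaging.iter (avOfRecord F N K) k U = Averaging.iter (avOfRecord F N K) k U') :
    OrbitRel k U U' := by
  have hseg : ∀ c : PBond (F.P K) k, holAt U (walk (embIter k c.src) (List.replicate ((F.P K).L ^ k) (c.dir, true))) =
      holAt U' (walk (embIter k c.src) (List.replicate ((F.P K).L ^ k) (c.dir, true))) := fun c => by
    have h1 := congrFun (iter_avOfRecord_eq_straight_of_flat (F := F) (N := N) hU k) c
    have h2 := congrFun (iter_avOfRecord_eq_straight_of_flat (F := F) (N := N) hU' k) c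
    rw [← h1, ← h2, h]
  obtain ⟨u, hu, huU⟩ := exists_gaugeAct_eq_of_segments U U' hseg hk (holFlat_of_flat hU) (holFlat_of_flat hU')
  exact ⟨u, hu, huU.symm⟩

/-- **A PLAQUETTE-FLAT FIELD IN THE CLASS IS A MINIMISER OVER ITS OWN `k`-FOLD AVERAGE**: `A(U_f) = 0 ≤ A(U)`. [cite: Balaban1987RG1, (0.21) p.256] -/
theorem isBackground_of_flat {K k : ℕ} {ε : ℝ} {U : GaugeField (F.P K) 0 (SU N)} (hU : ∀ p, plaqHol U p = 1) (hmem : U ∈ bgReg F N K k ε) :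
    IsBackground (avOfRecord F N K) (bgReg F N K k ε) k (Averaging.iter (avOfRecord F N K) k U) U := by
  refine ⟨rfl, hmem, fun U' _ _ => ?_⟩
  rw [wilsonAction4_eq_zero_of_holFlat U (holFlat_of_flat hU)]
  exact wilsonAction4_nonneg U'

/-- **A MINIMISER OVER A FLAT-SECTOR DATUM IS PLAQUETTE-FLAT**: if `U_f` is plaquette-flat and `U₀` is a (0.21) minimiser over `V = M^k(U_f)` in `bgReg … k ε`,
then `U_f` lies in the same (inhabited) class, `A(U₀) ≤ A(U_f) = 0`, so every plaquette of `U₀` is trivial (`Re tr W = 1 ⇒ W = 1` on `SU(N)`).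
[cite: Balaban1987RG1, (0.2) p.252, (0.21) p.256] -/
theorem flat_of_isBackground_of_flat {K k : ℕ} {ε : ℝ} {U U₀ : GaugeField (F.P K) 0 (SU N)} (hU : ∀ p, plaqHol U p = 1)
    (h : IsBackground (avOfRecord F N K) (bgReg F N K k ε) k (Averaging.iter (avOfRecord F N K) k U) U₀) : ∀ p, plaqHol U₀ p = 1 := by
  have hA : wilsonAction4 U₀ ≤ 0 := by
    have h1 := h.2.2 U (mem_bgReg_of_flat_of_mem hU h.2.1) rfl
    rwa [wilsonAction4_eq_zero_of_holFlat U (holFlat_of_flat hU)] at h1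
  exact plaqHol_eq_one_of_wilsonAction4_eq_zero U₀ (le_antisymm hA (wilsonAction4_nonneg U₀))

/-- Hence a minimiser over a flat-sector datum is on the residual orbit of the flat representative (`k ≤ m + K`).
[cite: Balaban1985Variational, Thm 1 p.279 and (4) p.278] -/
theorem orbitRel_of_isBackground_of_flat {K k : ℕ} (hk : k ≤ (F.P K).m + (F.P K).K) {ε : ℝ} {U U₀ : GaugeField (F.P K) 0 (SU N)}
    (hU : ∀ p, plaqHol U p = 1) (h : IsBackground (avOfRecord F N K) (bgReg F N K k ε) k (Averaging.iter (avOfRecord F N K) k U) U₀) :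
    OrbitRel k U U₀ :=
  orbitRel_of_flat_of_iter_eq hk hU (flat_of_isBackground_of_flat hU h) h.1.symm

/-- ★★ **[B11] THM 1's UNIQUENESS CLAUSE ON THE FLAT SECTOR** (N09's `h07sol`, second half; `h11` of the junction): at every datum `V = M^k(U_f)` with `U_f`
plaquette-flat, every level `k ≤ m + K` and EVERY radius `ε`, any two (0.21) minimisers lie on one residual orbit. [cite: Balaban1985Variational, Thm 1 p.279] -/
theorem uniqueUkOrbit_of_flat_iter {K k : ℕ} (hk : k ≤ (F.P K).m + (F.P K).K) (ε : ℝ) {U : GaugeField (F.P K) 0 (SU N)} (hU : ∀ p, plaqHol U p = 1) :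
    UniqueUkOrbit F N K k ε (Averaging.iter (avOfRecord F N K) k U) := fun _ _ h₀ h₀' =>
  (orbitRel_of_isBackground_of_flat hk hU h₀).symm.trans (orbitRel_of_isBackground_of_flat hk hU h₀')

/-- **[B11] THM 1's EXISTENCE CLAUSE ON THE FLAT SECTOR** (N09's `h07sol`, first half): the flat representative itself is a minimiser, every `ε > 0`.
[cite: Balaban1985Variational, Thm 1 p.279] -/
theorem ukExists_of_flat_iter {K : ℕ} (k : ℕ) {ε : ℝ} (hε : 0 < ε) {U : GaugeField (F.P K) 0 (SU N)} (hU : ∀ p, plaqHol U p = 1) :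
    UkExists F N K k ε (Averaging.iter (avOfRecord F N K) k U) :=
  ⟨U, isBackground_of_flat hU (mem_bgReg_of_flat hU k hε)⟩

/-- [B11] Thm 1 (1.1) — BOTH CLAUSES — on the flat sector (the door's `h07sol ∕ h11` read at a flat-sector datum). [cite: Balaban1985Variational, Thm 1 p.279] -/
theorem h11_of_flat_iter {K k : ℕ} (hk : k ≤ (F.P K).m + (F.P K).K) {ε : ℝ} (hε : 0 < ε) {U : GaugeField (F.P K) 0 (SU N)} (hU : ∀ p, plaqHol U p = 1) :
    UkExists F N K k ε (Averaging.iter (avOfRecord F N K) k U) ∧ UniqueUkOrbit F N K k ε (Averaging.iter (avOfRecord F N K) k U) :=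
  ⟨ukExists_of_flat_iter k hε hU, uniqueUkOrbit_of_flat_iter hk ε hU⟩

/-- **NODE 00's `U_k(V)` IS PLAQUETTE-FLAT ON THE FLAT SECTOR** (`ε > 0`: the chosen minimiser exists and has zero action). [cite: Balaban1987RG1, (0.21) p.256] -/
theorem flat_Uk_of_flat_iter {K : ℕ} (k : ℕ) {ε : ℝ} (hε : 0 < ε) {U : GaugeField (F.P K) 0 (SU N)} (hU : ∀ p, plaqHol U p = 1) :
    ∀ p, plaqHol (Uk F N K k ε (Averaging.iter (avOfRecord F N K) k U)) p = 1 :=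
  flat_of_isBackground_of_flat hU (isBackground_Uk (ukExists_of_flat_iter k hε hU))

/-- **`hreg8` ON THE FLAT SECTOR FOR EVERY PAIR OF RADII**: `U_k … ε V` lies in `bgReg … k′ ε′` for EVERY level `k′` and EVERY radius `ε′ > 0` (it is flat).
At the V18∕V19 witness (`εbg = 1`, `εreg = a₀`) this is the (8)-clause `hreg8` of the 28H door read at flat data — the two-radii obstruction
(dag-n09-w1 g2 `not_εbg_le_a₀_theta13OfThm1CCMW`) is invisible there. [cite: Balaban1985Variational, Thm 1 (8)–(10) p.279] -/
theorem Uk_mem_bgReg_of_flat_iter {K : ℕ} (k : ℕ) {ε : ℝ} (hε : 0 < ε) {U : GaugeField (F.P K) 0 (SU N)} (hU : ∀ p, plaqHol U p = 1)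
    (k' : ℕ) {ε' : ℝ} (hε' : 0 < ε') : Uk F N K k ε (Averaging.iter (avOfRecord F N K) k U) ∈ bgReg F N K k' ε' :=
  mem_bgReg_of_flat (flat_Uk_of_flat_iter k hε hU) k' hε'

/-- `U_k(M^k U_f)` lies on the residual orbit of `U_f` (`ε > 0`, `k ≤ m + K`). [cite: Balaban1985Variational, Thm 1 p.279] -/
theorem orbitRel_Uk_of_flat_iter {K k : ℕ} (hk : k ≤ (F.P K).m + (F.P K).K) {ε : ℝ} (hε : 0 < ε) {U : GaugeField (F.P K) 0 (SU N)}
    (hU : ∀ p, plaqHol U p = 1) : OrbitRel k U (Uk F N K k ε (Averaging.iter (avOfRecord F N K) k U)) :=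
  orbitRel_of_isBackground_of_flat hk hU (isBackground_Uk (ukExists_of_flat_iter k hε hU))

/-- **`h07res` ON THE FLAT SECTOR**: `HRestrict` holds on the set of flat-sector data — `U_k(V)` is flat there, hence a level-`(j+1)` minimiser over its own
`(j+1)`-fold average, every `ε > 0`. [cite: Balaban1985Variational, Thm 1 (8)–(10) p.279] -/
theorem hRestrict_of_flat_iter {K : ℕ} (k : ℕ) {ε : ℝ} (hε : 0 < ε) :
    HRestrict F N ε K k {V | ∃ U : GaugeField (F.P K) 0 (SU N), (∀ p, plaqHol U p = 1) ∧ Averaging.iter (avOfRecord F N K) k U = V} := by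
  rintro V ⟨U, hU, rfl⟩ j _
  exact isBackground_of_flat (flat_Uk_of_flat_iter k hε hU) (mem_bgReg_of_flat (flat_Uk_of_flat_iter k hε hU) (j + 1) hε)

/-- **`h07uniq` ON THE FLAT SECTOR**: uniqueness of the minimal orbit at every averaged minimiser `M^{j+1}(U_k V)`, `j < k ≤ m + K` — these data are again
in the flat sector (`U_k V` is flat). [cite: Balaban1985Variational, Thm 1 p.279; Balaban1987RG1, (1.1) p.260] -/
theorem huniq_of_flat_iter {K k : ℕ} (hk : k ≤ (F.P K).m + (F.P K).K) {ε : ℝ} (hε : 0 < ε) {U : GaugeField (F.P K) 0 (SU N)}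
    (hU : ∀ p, plaqHol U p = 1) :
    ∀ j < k, UniqueUkOrbit F N K (j + 1) ε (Averaging.iter (avOfRecord F N K) (j + 1) (Uk F N K k ε (Averaging.iter (avOfRecord F N K) k U))) :=
  fun _ hj => uniqueUkOrbit_of_flat_iter (by omega) ε (flat_Uk_of_flat_iter k hε hU)

/-- THE DOOR's [B11]-SIDE LIST ON THE FLAT SECTOR, packaged: on the set `S_k` of flat-sector data of level `k ≤ m + K`, at every radius `ε > 0`:
`h07sol` (existence ∧ uniqueness on `S_k`), `h07res` (`HRestrict … S_k`) and `h07uniq` (uniqueness at the averaged minimisers). [cite: Balaban1985Variational, Thm 1 p.279] -/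
theorem thm1Clauses_flatSector {K k : ℕ} (hk : k ≤ (F.P K).m + (F.P K).K) {ε : ℝ} (hε : 0 < ε) :
    (∀ V ∈ {V | ∃ U : GaugeField (F.P K) 0 (SU N), (∀ p, plaqHol U p = 1) ∧ Averaging.iter (avOfRecord F N K) k U = V},
        UkExists F N K k ε V ∧ UniqueUkOrbit F N K k ε V) ∧
      HRestrict F N ε K k {V | ∃ U : GaugeField (F.P K) 0 (SU N), (∀ p, plaqHol U p = 1) ∧ Averaging.iter (avOfRecord F N K) k U = V} ∧
      ∀ V ∈ {V | ∃ U : GaugeField (F.P K) 0 (SU N), (∀ p, plaqHol U p = 1) ∧ Averaging.iter (avOfRecord F N K) k U = V},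
        ∀ j < k, UniqueUkOrbit F N K (j + 1) ε (Averaging.iter (avOfRecord F N K) (j + 1) (Uk F N K k ε V)) := by
  refine ⟨?_, hRestrict_of_flat_iter k hε, ?_⟩
  · rintro V ⟨U, hU, rfl⟩
    exact h11_of_flat_iter hk hε hU
  · rintro V ⟨U, hU, rfl⟩
    exact huniq_of_flat_iter hk hε hU

/-! ## §3. At the trivial datum `V = 1 ∈ domAltOfRecord θ.ν K k` -/

/-- ★★ **[B11] THM 1's UNIQUENESS CLAUSE AT THE TRIVIAL COARSE FIELD**, every level `k ≤ m + K`, EVERY radius: the minimal orbit over `V = 1` is unique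
(dag-n09-w4 g2's `ukExists_one` is the existence half). [cite: Balaban1985Variational, Thm 1 p.279] -/
theorem uniqueUkOrbit_one {K k : ℕ} (hk : k ≤ (F.P K).m + (F.P K).K) (ε : ℝ) : UniqueUkOrbit F N K k ε (1 : GaugeField (F.P K) k (SU N)) := by
  have h := uniqueUkOrbit_of_flat_iter (F := F) (N := N) hk ε (flat_one (P := F.P K) (j := 0))
  rwa [iter_avOfRecord_one F N] at h

/-- [B11] (1.1), both clauses, at `V = 1` (`ε > 0`, `k ≤ m + K`) — the door's `h07sol` at the trivial datum. [cite: Balaban1985Variational, Thm 1 p.279] -/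
theorem h11_one {K k : ℕ} (hk : k ≤ (F.P K).m + (F.P K).K) {ε : ℝ} (hε : 0 < ε) :
    UkExists F N K k ε (1 : GaugeField (F.P K) k (SU N)) ∧ UniqueUkOrbit F N K k ε (1 : GaugeField (F.P K) k (SU N)) := by
  have h := h11_of_flat_iter (F := F) (N := N) hk hε (flat_one (P := F.P K) (j := 0))
  rwa [iter_avOfRecord_one F N] at h

/-- **`U_k(1)` IS RESIDUAL-PURE-GAUGE**: `OrbitRel k 1 (Uk F N K k ε 1)` (`ε > 0`, `k ≤ m + K`) — the chosen minimiser over the trivial datum is `1^{u}` with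
`u = 1` at the `k`-centres. [cite: Balaban1985Variational, (4) p.278; Balaban1987RG1, (0.21) p.256] -/
theorem orbitRel_one_Uk_one {K k : ℕ} (hk : k ≤ (F.P K).m + (F.P K).K) {ε : ℝ} (hε : 0 < ε) :
    OrbitRel k (1 : GaugeField (F.P K) 0 (SU N)) (Uk F N K k ε (1 : GaugeField (F.P K) k (SU N))) := by
  have h := orbitRel_Uk_of_flat_iter (F := F) (N := N) hk hε (flat_one (P := F.P K) (j := 0))
  rwa [iter_avOfRecord_one F N] at h

/-- `U_k(1)` is plaquette-flat (`ε > 0`). [cite: Balaban1987RG1, (0.21) p.256] -/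
theorem flat_Uk_one {K : ℕ} (k : ℕ) {ε : ℝ} (hε : 0 < ε) : ∀ p, plaqHol (Uk F N K k ε (1 : GaugeField (F.P K) k (SU N))) p = 1 := by
  have h := flat_Uk_of_flat_iter (F := F) (N := N) k hε (flat_one (P := F.P K) (j := 0))
  rwa [iter_avOfRecord_one F N] at h

/-- `hreg8` at `V = 1` for every pair of radii and every pair of levels: `Uk F N K k ε 1 ∈ bgReg F N K k′ ε′` (`ε, ε′ > 0`). [cite: Balaban1985Variational, Thm 1 (8)–(10) p.279] -/
theorem Uk_one_mem_bgReg {K : ℕ} (k : ℕ) {ε : ℝ} (hε : 0 < ε) (k' : ℕ) {ε' : ℝ} (hε' : 0 < ε') :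
    Uk F N K k ε (1 : GaugeField (F.P K) k (SU N)) ∈ bgReg F N K k' ε' :=
  mem_bgReg_of_flat (flat_Uk_one k hε) k' hε'

/-- `h07uniq` at `V = 1`: uniqueness at the averaged minimisers `M^{j+1}(U_k 1)`, `j < k ≤ m + K`, `ε > 0`. [cite: Balaban1985Variational, Thm 1 p.279] -/
theorem huniq_one {K k : ℕ} (hk : k ≤ (F.P K).m + (F.P K).K) {ε : ℝ} (hε : 0 < ε) :
    ∀ j < k, UniqueUkOrbit F N K (j + 1) ε (Averaging.iter (avOfRecord F N K) (j + 1) (Uk F N K k ε (1 : GaugeField (F.P K) k (SU N)))) := by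
  have h := huniq_of_flat_iter (F := F) (N := N) hk hε (flat_one (P := F.P K) (j := 0))
  rwa [iter_avOfRecord_one F N] at h

/-- `h07res` at `V = 1`: `HRestrict F N ε K k {1}` (`ε > 0`). [cite: Balaban1985Variational, Thm 1 (8)–(10) p.279] -/
theorem hRestrict_one {K : ℕ} (k : ℕ) {ε : ℝ} (hε : 0 < ε) : HRestrict F N ε K k {(1 : GaugeField (F.P K) k (SU N))} := by
  intro V hV j hj
  rw [Set.mem_singleton_iff] at hV
  subst hV
  exact hRestrict_of_flat_iter (F := F) (N := N) k hε 1 ⟨1, flat_one, iter_avOfRecord_one F N K k⟩ j hj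

/-- A6 ∕ non-vacuity of this file's antecedents AND of the door's [B11]-side list at one datum of every `domAlt_k`: the trivial datum `V = 1` IS in the flat
sector of every level (`U_f := 1`). [cite: Balaban1987RG1, (0.11) p.253 (bookkeeping)] -/
theorem one_mem_flatSector (K k : ℕ) :
    (1 : GaugeField (F.P K) k (SU N)) ∈ {V | ∃ U : GaugeField (F.P K) 0 (SU N), (∀ p, plaqHol U p = 1) ∧ Averaging.iter (avOfRecord F N K) k U = V} :=
  ⟨1, flat_one, iter_avOfRecord_one F N K k⟩

end Summit.QuantumFields.YangMills.BalabanUVNodes.N09FlatSectorUniqueness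

end
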